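import Summits.NavierStokesRegularity.NavierStokesRegularity.Theorems.RecurrentProfilesRecurrentReductionOrbit
import HarnessLib

/-!
# Crux `RecurrentLiouville` (stmt-NavierStokesRegularity-1589), line `Sketch` — stub `stub_rlClassLimit`:
# compactness of origin-singular Type-I profiles in the Albritton–Barker class

Theorems-only file (no definitions, no named facts).  Let `(v_k, q_k)` be suitable weak solutions
of Navier–Stokes (`ν = 1`, `f = 0`) on the backward slab `ℝ³ × ℝ₋ = (-∞, 0) × ℝ³` with weak
spatial gradients `H_k`, uniformly bounded Albritton–Barker quantity `𝐈(v_k, q_k, H_k) ≤ M < ∞`,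
the Type-I rate `‖v_k(t, x)‖ ≤ C/√(−t)` and a backward-singular origin.  Then along a subsequence
`ψ` the `v_{ψ j}` converge in `L³(Q(0, R))`, for every `R > 0`, to a field `w` which is again in the
class: suitable weak on the slab with a pressure `q'` and a weak gradient `H'`, `𝐈(w, q', H') < ∞`,
the rate POINTWISE, and a backward-singular origin (`stub_rlClassLimit`).

Proof: the tree's engine `slab_typeI_compactness` (Albritton–Barker 2019, Lemma 2.2 + Prop. 2.3
on the exhausting balls `Q(0, 2ᵐ)`; the persistence clause fires because EVERY approximant is
singular at the origin, so `limsup_j ‖v_{ψ j}‖_{L^∞(Q(0,R))} = ∞`), the bound `𝐈 ≤ 4 M < ∞`, the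
a.e. rate of `L³_loc` limits on the slab (`ae_rate_of_tendsto_eLpNorm`, KNSS (1.4)), and the
pointwise-rate representative `exists_rate_profile_repr` (a modification on a null subset of the
slab, which changes neither the pressure, the gradient, `𝐈 < ∞`, the singular origin, nor the
`L³(Q(0, R))` distances, `Q(0, R) ⊆ ℝ³ × ℝ₋`).

## References

* D. Albritton, T. Barker, J. Math. Fluid Mech. 21 (2019), no. 43 = arXiv:1811.00502, Lemma 2.2,
  Prop. 2.3, §3. [AlbrittonBarker2019]
* G. Koch, N. Nadirashvili, G. Seregin, V. Šverák, Acta Math. 203 (2009), (1.4). [KNSS2009]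
-/

noncomputable section

-- the sub-problem namespace repeats the summit name (D-0017 layout `Summit.<S>.<P>.Theorems`)
set_option linter.dupNamespace false

namespace Summit.NavierStokesRegularity.NavierStokesRegularity.Theorems

open MeasureTheory Set Function Filter Topology TopologicalSpace Metric
open Literature.Analysis.FluidPDE
open scoped NNReal ENNReal

/-- **Compactness of origin-singular Type-I profiles in the Albritton–Barker class.**  Suitable
weak solutions `(v_k, q_k)` on `ℝ³ × ℝ₋` with weak gradients `H_k`, `𝐈(v_k, q_k, H_k) ≤ M < ∞`, the
Type-I rate `‖v_k(t, x)‖ ≤ C/√(−t)` and a backward-singular origin subconverge in `L³(Q(0, R))`, for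
every `R > 0`, to a suitable weak solution `(w, q')` on `ℝ³ × ℝ₋` with a weak gradient `H'`,
`𝐈(w, q', H') < ∞`, the rate pointwise and a backward-singular origin: `slab_typeI_compactness`
(A–B Lemma 2.2 on the exhausting balls, `𝐈 ≤ 4 M`), persistence of singularities (A–B Prop. 2.3,
every approximant being singular at the origin), the rate a.e. along an a.e.-convergent
subsequence on each ball, and a modification on a null subset of the slab making it pointwise.
[cite: AlbrittonBarker2019, Lemma 2.2, Prop. 2.3 and §3] -/
theorem stub_rlClassLimit :
    ∀ (C : ℝ) (M : ℝ≥0∞), M < ⊤ →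
      ∀ (v : ℕ → ℝ → EuclideanSpace ℝ (Fin 3) → EuclideanSpace ℝ (Fin 3))
        (q : ℕ → ℝ → EuclideanSpace ℝ (Fin 3) → ℝ)
        (H : ℕ → ℝ → EuclideanSpace ℝ (Fin 3) → EuclideanSpace ℝ (Fin 3) →L[ℝ] EuclideanSpace ℝ (Fin 3)),
        (∀ k, IsSuitableWeakSolutionOn (slab (EuclideanSpace ℝ (Fin 3)) (Iio 0) isOpen_Iio) 1 0
          (v k) (q k)) →
        (∀ k, HasWeakSpatialGradientOn (slab (EuclideanSpace ℝ (Fin 3)) (Iio 0) isOpen_Iio)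
          (v k) (H k)) →
        (∀ k, typeIBound (Iio (0 : ℝ) ×ˢ univ) (v k) (q k) (H k) ≤ M) →
        (∀ k, HasTypeITimeDecay C (v k)) →
        (∀ k, IsBackwardSingularPoint (v k) 0) →
        ∃ (w : ℝ → EuclideanSpace ℝ (Fin 3) → EuclideanSpace ℝ (Fin 3))
          (q' : ℝ → EuclideanSpace ℝ (Fin 3) → ℝ)
          (H' : ℝ → EuclideanSpace ℝ (Fin 3) → EuclideanSpace ℝ (Fin 3) →L[ℝ] EuclideanSpace ℝ (Fin 3))
          (ψ : ℕ → ℕ), StrictMono ψ ∧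
          IsSuitableWeakSolutionOn (slab (EuclideanSpace ℝ (Fin 3)) (Iio 0) isOpen_Iio) 1 0 w q' ∧
          HasWeakSpatialGradientOn (slab (EuclideanSpace ℝ (Fin 3)) (Iio 0) isOpen_Iio) w H' ∧
          typeIBound (Iio (0 : ℝ) ×ˢ univ) w q' H' < ⊤ ∧
          HasTypeITimeDecay C w ∧
          IsBackwardSingularPoint w 0 ∧
          ∀ R : ℝ, 0 < R → Tendsto (fun j => eLpNorm (uncurry (v (ψ j)) - uncurry w) 3
            (volume.restrict (parabolicCylinder R (0 : ℝ × EuclideanSpace ℝ (Fin 3))))) atTop (𝓝 0) := by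
  intro C M hM v q H hsw hwg hbd hdec hsing
  -- `0 ≤ C`, from the rate of `v 0` at `(t, x) = (-1, 0)`
  have hC0 : 0 ≤ C := by
    have h := hdec 0 (-1) (by norm_num) 0
    have h1 : (0 : ℝ) ≤ C / Real.sqrt (-(-1 : ℝ)) := (norm_nonneg _).trans h
    rw [neg_neg, Real.sqrt_one, div_one] at h1
    exact h1
  -- ## compactness on the slab (A–B Lemma 2.2 on the exhausting balls)
  obtain ⟨u', p', H', ψ, hψ, hsw', hwg', hI', hconv, hpers⟩ :=
    slab_typeI_compactness M v q H hM hsw hwg hbd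
  -- ## every approximant is singular at the origin: persistence fires (A–B Prop. 2.3)
  have hsing' : IsBackwardSingularPoint u' 0 := by
    refine hpers fun R hR => ?_
    have e : (fun j => eLpNorm (uncurry (v (ψ j))) ⊤
        (volume.restrict (parabolicCylinder R (0 : ℝ × EuclideanSpace ℝ (Fin 3))))) = fun _ => ⊤ :=
      funext fun j => hsing (ψ j) R hR
    rw [e]
    exact limsup_const ⊤
  -- ## `𝐈(u') ≤ 4 M < ∞`
  have hI'' : typeIBound (Iio (0 : ℝ) ×ˢ univ) u' p' H' < ⊤ :=
    lt_of_le_of_lt hI' (ENNReal.mul_lt_top (by simp) hM)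
  -- ## the rate almost everywhere on the slab (measurability on the balls `Q(0, n+1) ⊆ ℝ³ × ℝ₋`)
  have hvm : ∀ (n : ℕ) (j : ℕ), AEStronglyMeasurable (uncurry (v (ψ j)))
      (volume.restrict (parabolicCylinder ((n : ℝ) + 1) (0 : ℝ × EuclideanSpace ℝ (Fin 3)))) :=
    fun n j => (hwg (ψ j)).locallyIntegrableOn.aestronglyMeasurable.mono_measure
      (Measure.restrict_mono (parabolicCylinder_origin_subset_slab _) le_rfl)
  have hwm : ∀ n : ℕ, AEStronglyMeasurable (uncurry u')
      (volume.restrict (parabolicCylinder ((n : ℝ) + 1) (0 : ℝ × EuclideanSpace ℝ (Fin 3)))) :=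
    fun n => hwg'.locallyIntegrableOn.aestronglyMeasurable.mono_measure
      (Measure.restrict_mono (parabolicCylinder_origin_subset_slab _) le_rfl)
  have hrate : ∀ᵐ z ∂(volume.restrict (Iio (0 : ℝ) ×ˢ (univ : Set (EuclideanSpace ℝ (Fin 3))))),
      ‖u' z.1 z.2‖ ≤ C / Real.sqrt (-z.1) :=
    ae_rate_of_tendsto_eLpNorm (v := fun j => v (ψ j)) (fun j => hdec (ψ j)) hvm hwm
      (fun n => hconv _ (by positivity))
  -- ## the pointwise rate: modification on a null subset of the slab
  obtain ⟨w, hae, hsww, hwgw, hIw, hdecw, hsingw⟩ :=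
    exists_rate_profile_repr hC0 hsw' hwg' hI'' hsing' hrate
  refine ⟨w, p', H', ψ, hψ, hsww, hwgw, hIw, hdecw, hsingw, fun R hR => ?_⟩
  -- `u' = w` a.e. on `Q(0, R) ⊆ ℝ³ × ℝ₋`, so the `L³(Q(0, R))` distances are unchanged
  have haeR : ∀ᵐ z ∂(volume.restrict (parabolicCylinder R (0 : ℝ × EuclideanSpace ℝ (Fin 3)))),
      uncurry u' z = uncurry w z :=
    ae_restrict_of_ae_restrict_of_subset (parabolicCylinder_origin_subset_slab R) hae
  refine (hconv R hR).congr fun j => eLpNorm_congr_ae ?_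
  filter_upwards [haeR] with z hz
  rw [Pi.sub_apply, Pi.sub_apply, hz]

end Summit.NavierStokesRegularity.NavierStokesRegularity.Theorems
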